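import Literature.AlgebraicGeometry.Motives.AbelianVarietyTorsionGaloisRepresentationFrobenius
import Literature.NumberTheory.DiophantineGeometry.AVIsogenyTateRationalEquivProofs
import HarnessLib

/-!
# Isogenous abelian varieties have the same `ℓ`-adic and the same mod-`ℓ` characteristic polynomials
# (Tate 1966, §1; Mumford, *Abelian Varieties*, §19; Serre–Tate 1968, §1)

Sources:

* J. Tate, *Endomorphisms of abelian varieties over finite fields*, Invent. Math. 2 (1966), §1;
  D. Mumford, *Abelian Varieties* (1970), §19, p. 172: an isogeny `f : A → B` induces an isomorphism
  `V_ℓ f : V_ℓ A ≅ V_ℓ B` of `ℚ_ℓ[Gal(k̄/k)]`-modules (the tree's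
  `nonempty_equiv_rationalTateRep_of_isIsogenous_holds`, `NumberTheory/DiophantineGeometry/AVIsogenyTateRationalEquivProofs`).
  [Tate1966Endomorphisms] [MumfordAV1970]
* J.-P. Serre, J. Tate, *Good reduction of abelian varieties*, Ann. of Math. 88 (1968), §1
  [`book:serrend-oeuvres-collected-papers-ii` p0447–0448]: `T_ℓ(A)`, `V_ℓ(A) = T_ℓ(A) ⊗ ℚ_ℓ`,
  `A_ℓ = T_ℓ/ℓT_ℓ`.  [SerreTate1968]
* J.-P. Serre, *Résumé des cours de 1985–1986* (Œuvres IV no. 136), §2.5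
  [`book:serrend-oeuvres-collected-papers-iv` p0054]: `G_K(ℓ)`, the image of `G_{K,ℓ}` in
  `GL(T_ℓ/ℓT_ℓ) ≃ GL_{2n}(F_ℓ)` "par réduction modulo `ℓ`".  [Serre1986Resume]

For ISOGENOUS abelian varieties `A, B` over a field `k` (tree predicate `IsIsogenous A B`, an isogeny
of ANY degree) and a prime `ℓ` invertible in `k`, for every `σ ∈ Gal(k̄/k)`:

1. `IsIsogenous.charpoly_rationalTateRep_eq` — `charpoly (σ | V_ℓ A) = charpoly (σ | V_ℓ B)`
   (conjugate endomorphisms, Mathlib `Representation.Equiv.conj_apply_self`, `LinearEquiv.charpoly_conj`);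
2. **`IsIsogenous.charpoly_tateRep_eq`** — `charpoly (σ | T_ℓ A) = charpoly (σ | T_ℓ B)` in `ℤ_ℓ[X]`
   (`ℤ_ℓ[X] → ℚ_ℓ[X]` is injective and `charpoly (σ | V_ℓ) = charpoly (σ | T_ℓ)`, the tree's
   `charpoly_rationalTateRep_eq_map`) — although `T_ℓ A` and `T_ℓ B` need NOT be isomorphic
   `ℤ_ℓ[Gal]`-modules when `ℓ` divides the degree of the isogeny;
3. **`IsIsogenous.charpoly_torsionMatrixRep_eq`** — hence the mod-`ℓ` representations
   `ρ̄_{A,ℓ}`, `ρ̄_{B,ℓ}` of `Motives/AbelianVarietyTorsionGaloisRepresentation` (in ANY bases of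
   `A[ℓ](k̄)`, `B[ℓ](k̄)`) have the same characteristic polynomials `det(X - ρ̄(σ)) ∈ 𝔽_ℓ[X]` — both are
   `charpoly (σ | T_ℓ) mod ℓ` (`charpoly_torsionMatrixRep_eq_map_charpoly_tateRep`, "par réduction
   modulo `ℓ`") — and in particular the same traces (`IsIsogenous.trace_torsionMatrixRep_eq`), although
   `A[ℓ]` and `B[ℓ]` need not be isomorphic Galois modules (so `k(A[ℓ]) ≠ k(B[ℓ])` in general, while
   `k^{(ℓ)}(A) = k^{(ℓ)}(B)`, the tree's `primaryDivisionField_eq_of_isIsogenous`);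
4. `IsIsogenous.hasFrobCharpolyAt_torsionFramedRep_iff` — over a number field, `ρ̄_{A,ℓ}` and `ρ̄_{B,ℓ}`
   have the same Frobenius characteristic polynomials at every place (`FramedGaloisRep.HasFrobCharpolyAt`).

Everything is PROVED; no named facts are introduced (net Literature debt **0**).  The elliptic-curve
case of 2 (traces) is the tree's `WeierstrassCurve.IsIsogenous.trace_galoisRepTate_eq`
(`EllipticCurves/IsogenyFrobeniusTraceProofs`).

## References

* [Tate1966Endomorphisms] J. Tate, *Endomorphisms of abelian varieties over finite fields*,
  Invent. Math. 2 (1966), §1.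
* [MumfordAV1970] D. Mumford, *Abelian Varieties* (1970), §19 (p. 172).
* [SerreTate1968] J.-P. Serre, J. Tate, *Good reduction of abelian varieties*, Ann. of Math. 88
  (1968), §1.
* [Serre1986Resume] J.-P. Serre, *Résumé des cours de 1985–1986*, Œuvres IV no. 136, §2.5.
-/

open CategoryTheory Polynomial
open scoped NumberField Pointwise Matrix TensorProduct

noncomputable section

namespace Literature.AlgebraicGeometry.Motives

namespace AbelianVariety

open Literature.NumberTheory.GaloisRepresentations (absIntegers FramedGaloisRep FramedRep)
open Literature.NumberTheory.DiophantineGeometry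

attribute [local instance] AddSubgroup.torsionBy.zmodModule

section AnyField

universe u

variable {k : Type u} [Field k] {A B : AbelianVariety k} {ℓ : ℕ} [Fact ℓ.Prime]

/-- `V_ℓ A = ℚ_ℓ ⊗ T_ℓ A` is finite-dimensional for `ℓ` invertible in `k` (universe-polymorphic copy of
the tree's `module_finite_rationalTateModule_of_cast_ne_zero`). [folklore] -/
private theorem module_finite_rationalTateModule_of_cast_ne_zero' (A : AbelianVariety k)
    (hℓ : (ℓ : k) ≠ 0) : Module.Finite ℚ_[ℓ] (A.rationalTateModule ℓ) := by
  haveI := module_finite_tateModule_of_cast_ne_zero A ℓ hℓ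
  change Module.Finite ℚ_[ℓ] (ℚ_[ℓ] ⊗[ℤ_[ℓ]] A.tateModule ℓ)
  infer_instance

/-- **Isogenous abelian varieties have conjugate rational `ℓ`-adic representations, hence equal
characteristic polynomials on `V_ℓ`**: `charpoly (σ | V_ℓ A) = charpoly (σ | V_ℓ B)` for every
`σ ∈ Gal(k̄/k)` (any prime `ℓ`; the tree's `V_ℓ A ≅ V_ℓ B`, `nonempty_equiv_rationalTateRep_of_isIsogenous_holds`).
[cite: Tate1966Endomorphisms, §1] [cite: MumfordAV1970, §19 (p. 172)] -/
theorem IsIsogenous.charpoly_rationalTateRep_eq (h : IsIsogenous A B)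
    [Module.Finite ℚ_[ℓ] (A.rationalTateModule ℓ)] [Module.Finite ℚ_[ℓ] (B.rationalTateModule ℓ)]
    (σ : Field.absoluteGaloisGroup k) :
    (A.rationalTateRep ℓ σ).charpoly = (B.rationalTateRep ℓ σ).charpoly := by
  obtain ⟨φ⟩ := nonempty_equiv_rationalTateRep_of_isIsogenous_holds (A := A) (B := B) h ℓ
  rw [← Representation.Equiv.conj_apply_self σ φ]
  exact (LinearEquiv.charpoly_conj _ _).symm

/-- **Isogenous abelian varieties have the same integral `ℓ`-adic characteristic polynomials**:
`charpoly (σ | T_ℓ A) = charpoly (σ | T_ℓ B)` in `ℤ_ℓ[X]` for every `σ ∈ Gal(k̄/k)` — from the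
rational statement, since `charpoly (σ | V_ℓ) = charpoly (σ | T_ℓ)` viewed in `ℚ_ℓ[X]` (the tree's
`charpoly_rationalTateRep_eq_map`) and `ℤ_ℓ[X] → ℚ_ℓ[X]` is injective.  (`T_ℓ A` and `T_ℓ B`
themselves need not be isomorphic Galois modules.)  The instances hold for `ℓ` invertible in `k`
(the tree's `module_free_tateModule_holds`, `module_finite_tateModule_of_cast_ne_zero`; see the
`_of_natCast_ne_zero` form).
[cite: Tate1966Endomorphisms, §1] [cite: SerreTate1968, §1 (p. 493, `V_ℓ = T_ℓ ⊗ ℚ_ℓ`)] -/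
theorem IsIsogenous.charpoly_tateRep_eq (h : IsIsogenous A B)
    [Module.Free ℤ_[ℓ] (A.tateModule ℓ)] [Module.Finite ℤ_[ℓ] (A.tateModule ℓ)]
    [Module.Free ℤ_[ℓ] (B.tateModule ℓ)] [Module.Finite ℤ_[ℓ] (B.tateModule ℓ)]
    [Module.Finite ℚ_[ℓ] (A.rationalTateModule ℓ)] [Module.Finite ℚ_[ℓ] (B.rationalTateModule ℓ)]
    (σ : Field.absoluteGaloisGroup k) :
    (A.tateRep ℓ σ).charpoly = (B.tateRep ℓ σ).charpoly := by
  apply Polynomial.map_injective (algebraMap ℤ_[ℓ] ℚ_[ℓ]) (IsFractionRing.injective ℤ_[ℓ] ℚ_[ℓ])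
  rw [← A.charpoly_rationalTateRep_eq_map ℓ σ, ← B.charpoly_rationalTateRep_eq_map ℓ σ]
  exact h.charpoly_rationalTateRep_eq σ

/-- Unconditional form of `IsIsogenous.charpoly_tateRep_eq` for `ℓ` invertible in `k` (the
instances supplied by the tree's theorems). [cite: Tate1966Endomorphisms, §1] [cite: SerreTate1968, §1 (p. 493)] -/
theorem IsIsogenous.charpoly_tateRep_eq_of_natCast_ne_zero (h : IsIsogenous A B) (hℓ : (ℓ : k) ≠ 0)
    (σ : Field.absoluteGaloisGroup k) :
    haveI := A.module_free_tateModule_holds ℓ hℓ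
    haveI := module_finite_tateModule_of_cast_ne_zero A ℓ hℓ
    haveI := B.module_free_tateModule_holds ℓ hℓ
    haveI := module_finite_tateModule_of_cast_ne_zero B ℓ hℓ
    (A.tateRep ℓ σ).charpoly = (B.tateRep ℓ σ).charpoly := by
  haveI := A.module_free_tateModule_holds ℓ hℓ
  haveI := module_finite_tateModule_of_cast_ne_zero A ℓ hℓ
  haveI := B.module_free_tateModule_holds ℓ hℓ
  haveI := module_finite_tateModule_of_cast_ne_zero B ℓ hℓ
  haveI := module_finite_rationalTateModule_of_cast_ne_zero' A hℓ
  haveI := module_finite_rationalTateModule_of_cast_ne_zero' B hℓ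
  exact h.charpoly_tateRep_eq σ

variable {d d' : ℕ}

/-- **Isogenous abelian varieties have the same mod-`ℓ` characteristic polynomials**: for `ℓ`
invertible in `k`, any `ℤ/ℓ`-bases `b` of `A[ℓ](k̄)` and `b'` of `B[ℓ](k̄)` and every `σ ∈ Gal(k̄/k)`,
`det(X - ρ̄_{A,ℓ}(σ)) = det(X - ρ̄_{B,ℓ}(σ))` in `𝔽_ℓ[X]` — both are `charpoly (σ | T_ℓ) mod ℓ`
(`charpoly_torsionMatrixRep_eq_map_charpoly_tateRep`, "par réduction modulo `ℓ`"), and the `ℓ`-adic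
polynomials agree (`IsIsogenous.charpoly_tateRep_eq`).  (The Galois modules `A[ℓ]`, `B[ℓ]` need not
be isomorphic when `ℓ` divides the degree of the isogeny.)
[cite: Tate1966Endomorphisms, §1] [cite: Serre1986Resume, §2.5] [cite: SerreTate1968, §1 (p. 493, `A_ℓ = T_ℓ/ℓT_ℓ`)] -/
theorem IsIsogenous.charpoly_torsionMatrixRep_eq (h : IsIsogenous A B) (hℓ : (ℓ : k) ≠ 0)
    (b : Module.Basis (Fin d) (ZMod ℓ) (A.geomTorsion ℓ)) (b' : Module.Basis (Fin d') (ZMod ℓ) (B.geomTorsion ℓ))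
    (σ : Field.absoluteGaloisGroup k) :
    ((A.torsionMatrixRep b σ : GL (Fin d) (ZMod ℓ)) : Matrix (Fin d) (Fin d) (ZMod ℓ)).charpoly =
      ((B.torsionMatrixRep b' σ : GL (Fin d') (ZMod ℓ)) : Matrix (Fin d') (Fin d') (ZMod ℓ)).charpoly := by
  haveI := A.module_free_tateModule_holds ℓ hℓ
  haveI := module_finite_tateModule_of_cast_ne_zero A ℓ hℓ
  haveI := B.module_free_tateModule_holds ℓ hℓ
  haveI := module_finite_tateModule_of_cast_ne_zero B ℓ hℓ
  haveI := module_finite_rationalTateModule_of_cast_ne_zero' A hℓ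
  haveI := module_finite_rationalTateModule_of_cast_ne_zero' B hℓ
  rw [A.charpoly_torsionMatrixRep_eq_map_charpoly_tateRep hℓ b σ,
    B.charpoly_torsionMatrixRep_eq_map_charpoly_tateRep hℓ b' σ, h.charpoly_tateRep_eq σ]

/-- Framed form: the framed mod-`ℓ` representations of isogenous abelian varieties have the same
characteristic polynomials (`FramedRep.charpoly`). [cite: Tate1966Endomorphisms, §1] [cite: Serre1986Resume, §2.5] -/
theorem IsIsogenous.charpoly_torsionFramedRep_eq (h : IsIsogenous A B) (hℓ : (ℓ : k) ≠ 0)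
    (b : Module.Basis (Fin d) (ZMod ℓ) (A.geomTorsion ℓ)) (b' : Module.Basis (Fin d') (ZMod ℓ) (B.geomTorsion ℓ))
    (σ : Field.absoluteGaloisGroup k) :
    FramedRep.charpoly (A.torsionFramedRep b) σ = FramedRep.charpoly (B.torsionFramedRep b') σ :=
  h.charpoly_torsionMatrixRep_eq hℓ b b' σ

/-- **Isogenous abelian varieties have the same mod-`ℓ` traces** `tr ρ̄_{A,ℓ}(σ) = tr ρ̄_{B,ℓ}(σ)`
(`ℓ` invertible in `k`; Mathlib `Matrix.trace_eq_neg_charpoly_nextCoeff`).  The elliptic-curve,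
`ℓ`-adic case is the tree's `WeierstrassCurve.IsIsogenous.trace_galoisRepTate_eq`.
[cite: Tate1966Endomorphisms, §1] [cite: Serre1986Resume, §2.5] -/
theorem IsIsogenous.trace_torsionMatrixRep_eq (h : IsIsogenous A B) (hℓ : (ℓ : k) ≠ 0)
    (b : Module.Basis (Fin d) (ZMod ℓ) (A.geomTorsion ℓ)) (b' : Module.Basis (Fin d') (ZMod ℓ) (B.geomTorsion ℓ))
    (σ : Field.absoluteGaloisGroup k) :
    ((A.torsionMatrixRep b σ : GL (Fin d) (ZMod ℓ)) : Matrix (Fin d) (Fin d) (ZMod ℓ)).trace =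
      ((B.torsionMatrixRep b' σ : GL (Fin d') (ZMod ℓ)) : Matrix (Fin d') (Fin d') (ZMod ℓ)).trace := by
  rw [Matrix.trace_eq_neg_charpoly_nextCoeff, Matrix.trace_eq_neg_charpoly_nextCoeff,
    h.charpoly_torsionMatrixRep_eq hℓ b b' σ]

/-- **… and the same mod-`ℓ` determinants** `det ρ̄_{A,ℓ}(σ) = det ρ̄_{B,ℓ}(σ)` (Mathlib
`Matrix.det_eq_sign_charpoly_coeff`; the index cardinalities agree, both being `2 dim`, and
isogenous varieties have equal characteristic polynomials hence equal degrees).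
[cite: Tate1966Endomorphisms, §1] [cite: Serre1986Resume, §2.5] -/
theorem IsIsogenous.det_torsionMatrixRep_eq (h : IsIsogenous A B) (hℓ : (ℓ : k) ≠ 0)
    (b : Module.Basis (Fin d) (ZMod ℓ) (A.geomTorsion ℓ)) (b' : Module.Basis (Fin d') (ZMod ℓ) (B.geomTorsion ℓ))
    (σ : Field.absoluteGaloisGroup k) :
    ((A.torsionMatrixRep b σ : GL (Fin d) (ZMod ℓ)) : Matrix (Fin d) (Fin d) (ZMod ℓ)).det =
      ((B.torsionMatrixRep b' σ : GL (Fin d') (ZMod ℓ)) : Matrix (Fin d') (Fin d') (ZMod ℓ)).det := by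
  have hc := h.charpoly_torsionMatrixRep_eq hℓ b b' σ
  have hd : Fintype.card (Fin d) = Fintype.card (Fin d') := by
    have h1 := Matrix.charpoly_natDegree_eq_dim
      ((A.torsionMatrixRep b σ : GL (Fin d) (ZMod ℓ)) : Matrix (Fin d) (Fin d) (ZMod ℓ))
    have h2 := Matrix.charpoly_natDegree_eq_dim
      ((B.torsionMatrixRep b' σ : GL (Fin d') (ZMod ℓ)) : Matrix (Fin d') (Fin d') (ZMod ℓ))
    rw [← h1, ← h2, hc]
  rw [Matrix.det_eq_sign_charpoly_coeff, Matrix.det_eq_sign_charpoly_coeff, hc, hd]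

end AnyField

/-! ## Over a number field: the same Frobenius polynomials modulo `ℓ` -/

section NumberField

variable {k : Type} [Field k] [NumberField k] {A B : AbelianVariety k} {ℓ : ℕ} [Fact ℓ.Prime]

omit [NumberField k] in
/-- A prime is non-zero in a field of characteristic zero. [folklore] -/
private theorem natCast_prime_ne_zero₄ (ℓ : ℕ) [Fact ℓ.Prime] [CharZero k] : (ℓ : k) ≠ 0 := by
  exact_mod_cast (Fact.out : ℓ.Prime).ne_zero

/-- **Isogenous abelian varieties over a number field have the same mod-`ℓ` Frobenius polynomials**:
for any bases of `A[ℓ](k̄)`, `B[ℓ](k̄)`, any place `v` and any `P ∈ 𝔽_ℓ[X]`, `ρ̄_{A,ℓ}` has Frobenius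
characteristic polynomial `P` at `v` iff `ρ̄_{B,ℓ}` does (`FramedGaloisRep.HasFrobCharpolyAt`:
every arithmetic Frobenius at every prime above `v`). [cite: Tate1966Endomorphisms, §1] [cite: Serre1986Resume, §2.5] -/
theorem IsIsogenous.hasFrobCharpolyAt_torsionFramedRep_iff (h : IsIsogenous A B) {d d' : ℕ}
    (b : Module.Basis (Fin d) (ZMod ℓ) (A.geomTorsion ℓ)) (b' : Module.Basis (Fin d') (ZMod ℓ) (B.geomTorsion ℓ))
    (v : IsDedekindDomain.HeightOneSpectrum (𝓞 k)) (P : (ZMod ℓ)[X]) :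
    (A.torsionFramedRep b).HasFrobCharpolyAt v P ↔ (B.torsionFramedRep b').HasFrobCharpolyAt v P := by
  refine forall₂_congr fun 𝔓 _ => forall₂_congr fun σ _ => ?_
  rw [h.charpoly_torsionFramedRep_eq (natCast_prime_ne_zero₄ ℓ) b b' σ]

end NumberField

end AbelianVariety

end Literature.AlgebraicGeometry.Motives

end
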